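import Summits.QuantumFields.YangMills.Theorems.AlphaInputsT3ACv3LinearLiftLocal
import Summits.QuantumFields.YangMills.Theorems.AlphaInputsT3ACv3AbelianLiftAvg
import HarnessLib

/-!
# `AlphaInputsT3ACv3LinearLiftMatrix` — (V) THE MATRIX-VALUED PORT OF THE (LL) ENGINE, PART 1: the ENTRYWISE EXTENSION `byEntry` of a scalar lattice operator to
# `M_n(ℂ)`-valued fields (kernel form, equivariance, submodule ∕ `𝔰𝔲(N)` preservation, `ℓ^∞`-bounds ported with the SAME constant) and the engine's scalar operators
# (`linAvg04`, `linAvgIter`, `S1`, `psiIter`, ★ `lift`) as `ℝ`-LINEAR MAPS — cell `ym3-torus`, width seat `ym-ust-19936-w3` (g0)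

WHY (OWNER RULING g24-№4, ym3-torus STATUS 2026-08-28T00:44:44Z: «(FL)_non-ab ⇐ hLift ⇐ Newton[(LL)-regional (alpha-2) ⊕ (V) (w3) ⊕ (B2) (w1) ⊕ k-uniform sup bounds (w1)]»).
The non-abelian (FL) row of 2′∕2′χ (`AlphaInputsT3AC.InnerFineLiftsT3`, `…v3InnerLiftFine`) is to be supplied KINEMATICALLY by Newton∕IFT on the exact linear lift.  The linear
step is the SCALAR (LL) engine of record (`LinearLiftSpread.lift`, ★`linAvgIter_lift`, ★`curlAt_lift`, `abs_curlAt_lift_le_local` — seat w2; regional twin — seat alpha-2;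
k-uniform sup bounds `…v3LinearAvgSup` — seat w1), while the Newton candidates are `𝔰𝔲(2)`-valued one-forms whose defect is read through the MATRIX linearised (0.4) average
`BlockAveragingEMLLinearised.linAvg` ((B2); its coordinatewise naturality `LinearAvgMatrix.apply_linAvg` is w1's).  THIS FILE is part 1 of the typed seam (V) (part 2 =
`…v3LinearLiftMatrixLift`: `liftM`, exactness, `𝔰𝔲(N)`-valuedness, curl and sup bounds, `Lift_{t→s}`):
* §1 `byEntry T A` — the ENTRYWISE EXTENSION of a scalar lattice operator `T : (ι → ℝ) → (κ → ℝ)` to `M_n(ℂ)`-valued fields (on the real and the imaginary part of every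
  entry); functoriality `byEntry_comp` ∕ `byEntry_id` (so EXACTNESS identities `T ∘ S = id` port for free); for LINEAR `T` the kernel form ★ `byEntry_eq_sum_kernel :
  byEntry T A b = Σ_c T(δ_c)(b) • A c`, whence equivariance under every `ℝ`-linear map of the coefficients applied pointwise (`map_byEntry`, `map_byEntry_eq`: change of
  basis of `𝔤`, `Ad` of a CONSTANT group element, frame rotations), preservation of every `ℝ`-submodule (★ `byEntry_mem` — so of `𝔰𝔲(N) =
  Literature.Algebra.Lie.CompactKillingForm.su`), and ★★ `norm_byEntry_le_of_bound`: an `ℓ^∞ → ℓ^∞` bound «`|T f (b)| ≤ C·M` whenever `|f c| ≤ M` on a sub-family `N`»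
  ports VERBATIM to «`‖byEntry T A b‖ ≤ C·M` whenever `‖A c‖ ≤ M` on `N`» in the operator norm (`sum_abs_kernel_le_of_bound`: test `T` on the sign pattern of its own
  kernel row; `kernel_eq_zero_of_bound`) — the device by which every k-UNIFORM scalar sup bound of the engine becomes a matrix bound with the SAME constant, with NO
  dimension-of-the-group factor (compare the `2|n|²` of an entry-by-entry count).
* §2 linearity of the engine's scalar operators (`wsum_smul`, `linAvg04_smul`, `linAvgIter_smul`, `stairMean_add∕_smul`, `ptMean_add∕_smul`, `psiIter_add∕_smul`,
  `dgrad_smul`, `S1_add∕_smul`, ★ `lift_add` ∕ `lift_smul`) and their packaging as `ℝ`-linear maps `linAvg04L`, `linAvgIterL s`, `S1L k`, `psiIterL s`, ★ `liftL k` (the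
  arguments of §1's port theorems).
HONEST FRAMING.  Finite-dimensional real linear algebra over the lattice tori of [Balaban1987RG1] (0.1)–(0.4); nothing of [Balaban1985UV3]∕[Balaban1985Variational]∕
[Balaban1985Averaging] is asserted; (FL), the stub 2′χ `stub_laneRecordsV3Chi`, the crux `HistoryTailL` and any gap are NOT claimed; count-neutral helper
(`--supports stmt-QuantumFields-19936`); registry untouched.  YM₃ on the three-torus is a RUNG of the programme (UV stability ∕ continuum limit on T³), not the Clay problem;
nothing here is about d = 4, infinite volume or a mass gap.

References: T. Bałaban, Commun. Math. Phys. 109 (1987) 249–301 [Balaban1987RG1] ((0.3)–(0.4) pp.252–253, (0.11) p.253); B. C. Hall, Lie Groups, Lie Algebras, and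
Representations (2015) [Hall2015] (Example 7.3: `𝔰𝔲(n)` as a real subspace of `M_n(ℂ)`).
-/

set_option autoImplicit false

noncomputable section

open scoped Matrix.Norms.L2Operator

namespace Summit.QuantumFields.YangMills.Theorems.LinearLiftMatrix

open Finset
open Literature.MathematicalPhysics.QuantumFieldTheory.Balaban1983to89
open Literature.MathematicalPhysics.QuantumFieldTheory.Balaban1983to89.T4Continuum
open Literature.MathematicalPhysics.QuantumFieldTheory.Balaban1983to89.BlockAveraging (off Idx)
open Literature.MathematicalPhysics.QuantumFieldTheory.Balaban1985CMP102.Setting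
open Summit.QuantumFields.Balaban3D.Carriers
open Summit.QuantumFields.YangMills.Theorems.AbelianEML (wsum wsum_nil wsum_cons_true wsum_cons_false loopSum axialSum linAvg04 linAvgIter linAvgIter_succ
  curlAt stairMean stairSum segMean wsum_add linAvg04_add linAvgIter_add offPt)
open Summit.QuantumFields.YangMills.Theorems.LinearLiftGauge (dgrad dgrad_add ptMean psiIter)
open Summit.QuantumFields.YangMills.Theorems.LinearLiftProfile
open Summit.QuantumFields.YangMills.Theorems.LinearLiftSpread (hh S1 S2 lift)

variable {P : Params} {j : ℕ}

/-! ## §1 The entrywise extension of a scalar lattice operator to matrix fields -/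

section ByEntry

variable {n : Type*} {ι κ θ : Type*}

/-- **THE ENTRYWISE EXTENSION** of a scalar lattice operator `T : (ι → ℝ) → (κ → ℝ)` to `M_n(ℂ)`-valued fields: `T` applied to the real and to the imaginary part of every
entry. [folklore] -/
def byEntry (T : (ι → ℝ) → (κ → ℝ)) (A : ι → Matrix n n ℂ) : κ → Matrix n n ℂ :=
  fun b => Matrix.of fun i l => (⟨T (fun c => (A c i l).re) b, T (fun c => (A c i l).im) b⟩ : ℂ)

/-- The real part of an entry of `byEntry T A b`. [folklore] -/
@[simp] theorem byEntry_apply_re (T : (ι → ℝ) → (κ → ℝ)) (A : ι → Matrix n n ℂ) (b : κ) (i l : n) :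
    (byEntry T A b i l).re = T (fun c => (A c i l).re) b := rfl

/-- The imaginary part of an entry of `byEntry T A b`. [folklore] -/
@[simp] theorem byEntry_apply_im (T : (ι → ℝ) → (κ → ℝ)) (A : ι → Matrix n n ℂ) (b : κ) (i l : n) :
    (byEntry T A b i l).im = T (fun c => (A c i l).im) b := rfl

/-- **FUNCTORIALITY**: `byEntry T ∘ byEntry S = byEntry (T ∘ S)`. [folklore] -/
theorem byEntry_comp (T : (κ → ℝ) → (θ → ℝ)) (S : (ι → ℝ) → (κ → ℝ)) (A : ι → Matrix n n ℂ) :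
    byEntry T (byEntry S A) = byEntry (T ∘ S) A := by
  funext b; ext i l
  apply Complex.ext <;> rfl

/-- `byEntry id = id`. [folklore] -/
@[simp] theorem byEntry_id (A : ι → Matrix n n ℂ) : byEntry (id : (ι → ℝ) → (ι → ℝ)) A = A := by
  funext b; ext i l
  apply Complex.ext <;> rfl

/-- `byEntry` only depends on the values of the operator. [folklore] -/
theorem byEntry_congr {T T' : (ι → ℝ) → (κ → ℝ)} (h : ∀ f, T f = T' f) (A : ι → Matrix n n ℂ) : byEntry T A = byEntry T' A := by
  have : T = T' := funext h
  rw [this]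

variable [Fintype ι] [DecidableEq ι]

/-- A linear scalar operator is given by its kernel: `T f (b) = Σ_c T(δ_c)(b) · f c`. [folklore] -/
theorem apply_eq_sum_kernel (T : (ι → ℝ) →ₗ[ℝ] (κ → ℝ)) (f : ι → ℝ) (b : κ) :
    T f b = ∑ c, T (Pi.single c 1) b * f c := by
  conv_lhs => rw [pi_eq_sum_univ' f, map_sum]
  rw [Finset.sum_apply]
  refine sum_congr rfl fun c _ => ?_
  rw [LinearMap.map_smul, Pi.smul_apply, smul_eq_mul, mul_comm]

/-- **★ THE KERNEL FORM OF THE ENTRYWISE EXTENSION OF A LINEAR OPERATOR**: `byEntry T A b = Σ_c T(δ_c)(b) • A c` (real scalars acting on complex matrices). [folklore] -/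
theorem byEntry_eq_sum_kernel (T : (ι → ℝ) →ₗ[ℝ] (κ → ℝ)) (A : ι → Matrix n n ℂ) (b : κ) :
    byEntry T A b = ∑ c, (T (Pi.single c 1) b) • A c := by
  ext i l
  apply Complex.ext
  · rw [byEntry_apply_re, apply_eq_sum_kernel, Matrix.sum_apply, Complex.re_sum]
    refine sum_congr rfl fun c _ => ?_
    rw [Matrix.smul_apply, Complex.smul_re, smul_eq_mul]
  · rw [byEntry_apply_im, apply_eq_sum_kernel, Matrix.sum_apply, Complex.im_sum]
    refine sum_congr rfl fun c _ => ?_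
    rw [Matrix.smul_apply, Complex.smul_im, smul_eq_mul]

/-- **EQUIVARIANCE**: the entrywise extension of a LINEAR operator commutes with every `ℝ`-linear map of the coefficient space applied pointwise (change of basis of `𝔤`,
`Ad` of a CONSTANT group element, projections). [folklore] -/
theorem map_byEntry {W : Type*} [AddCommGroup W] [Module ℝ W] (T : (ι → ℝ) →ₗ[ℝ] (κ → ℝ)) (ψ : Matrix n n ℂ →ₗ[ℝ] W) (A : ι → Matrix n n ℂ) (b : κ) :
    ψ (byEntry T A b) = ∑ c, (T (Pi.single c 1) b) • ψ (A c) := by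
  rw [byEntry_eq_sum_kernel, map_sum]
  simp only [LinearMap.map_smul]

/-- Equivariance, endomorphism form: `ψ ∘ byEntry T A = byEntry T (ψ ∘ A)`. [folklore] -/
theorem map_byEntry_eq (T : (ι → ℝ) →ₗ[ℝ] (κ → ℝ)) (ψ : Matrix n n ℂ →ₗ[ℝ] Matrix n n ℂ) (A : ι → Matrix n n ℂ) (b : κ) :
    ψ (byEntry T A b) = byEntry T (fun c => ψ (A c)) b := by
  rw [map_byEntry, byEntry_eq_sum_kernel]

/-- **★ SUBMODULE PRESERVATION**: if every `A c` lies in an `ℝ`-submodule `S` of `M_n(ℂ)` (e.g. `𝔰𝔲(N)`), so does every value of the entrywise extension of a LINEAR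
operator. [folklore] -/
theorem byEntry_mem (T : (ι → ℝ) →ₗ[ℝ] (κ → ℝ)) (S : Submodule ℝ (Matrix n n ℂ)) {A : ι → Matrix n n ℂ} (hA : ∀ c, A c ∈ S) (b : κ) :
    byEntry T A b ∈ S := by
  rw [byEntry_eq_sum_kernel]
  exact S.sum_mem fun c _ => S.smul_mem _ (hA c)

/-- **THE `ℓ¹`-NORM OF A KERNEL ROW FROM AN `ℓ^∞ → ℓ^∞` BOUND**: if `|T f (b)| ≤ C · M` whenever `|f c| ≤ M` on a sub-family `N` (no hypothesis off `N`), then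
`Σ_c |T(δ_c)(b)| ≤ C` (test `T` on the sign pattern of its own kernel row). [folklore] -/
theorem sum_abs_kernel_le_of_bound (T : (ι → ℝ) →ₗ[ℝ] (κ → ℝ)) (N : ι → Prop) (b : κ) {C : ℝ}
    (hT : ∀ (f : ι → ℝ) (M : ℝ), (∀ c, N c → |f c| ≤ M) → |T f b| ≤ C * M) :
    ∑ c, |T (Pi.single c 1) b| ≤ C := by
  let f : ι → ℝ := fun c => if 0 ≤ T (Pi.single c 1) b then 1 else -1
  have hf : ∀ c, N c → |f c| ≤ 1 := fun c _ => by
    by_cases h : 0 ≤ T (Pi.single c 1) b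
    · simp [f, if_pos h]
    · simp [f, if_neg h]
  have hTf : T f b = ∑ c, |T (Pi.single c 1) b| := by
    rw [apply_eq_sum_kernel]
    refine sum_congr rfl fun c _ => ?_
    by_cases h : 0 ≤ T (Pi.single c 1) b
    · simp only [f, if_pos h, mul_one, abs_of_nonneg h]
    · simp only [f, if_neg h, mul_neg, mul_one, abs_of_neg (lt_of_not_ge h)]
  have h := hT f 1 hf
  rw [hTf, mul_one] at h
  exact (le_abs_self _).trans h

omit [Fintype ι] in
/-- Off the sub-family the kernel row vanishes (apply the bound with `M = 0` to `δ_c`). [folklore] -/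
theorem kernel_eq_zero_of_bound (T : (ι → ℝ) →ₗ[ℝ] (κ → ℝ)) (N : ι → Prop) (b : κ) {C : ℝ}
    (hT : ∀ (f : ι → ℝ) (M : ℝ), (∀ c, N c → |f c| ≤ M) → |T f b| ≤ C * M) {c : ι} (hc : ¬ N c) :
    T (Pi.single c 1) b = 0 := by
  have h := hT (Pi.single c 1) 0 fun c' hc' => by
    have hne : c' ≠ c := fun h => hc (h ▸ hc')
    rw [Pi.single_apply, if_neg hne, abs_zero]
  rw [mul_zero] at h
  exact abs_eq_zero.mp (le_antisymm h (abs_nonneg _))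

variable [Fintype n] [DecidableEq n]

/-- **★★ THE PORT OF AN `ℓ^∞` BOUND, SAME CONSTANT**: if the LINEAR scalar operator satisfies `|T f (b)| ≤ C · M` whenever `|f c| ≤ M` on the sub-family `N`, then its
entrywise extension satisfies `‖byEntry T A b‖ ≤ C · M` whenever `‖A c‖ ≤ M` on `N` (operator norm; any `ℝ`-normed structure would do). [folklore] -/
theorem norm_byEntry_le_of_bound (T : (ι → ℝ) →ₗ[ℝ] (κ → ℝ)) (N : ι → Prop) (b : κ) {C : ℝ}
    (hT : ∀ (f : ι → ℝ) (M : ℝ), (∀ c, N c → |f c| ≤ M) → |T f b| ≤ C * M)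
    (A : ι → Matrix n n ℂ) {M : ℝ} (hM : 0 ≤ M) (hA : ∀ c, N c → ‖A c‖ ≤ M) :
    ‖byEntry T A b‖ ≤ C * M := by
  classical
  rw [byEntry_eq_sum_kernel]
  have hterm : ∀ c, ‖(T (Pi.single c 1) b) • A c‖ ≤ |T (Pi.single c 1) b| * M := fun c => by
    rw [norm_smul, Real.norm_eq_abs]
    by_cases hc : N c
    · exact mul_le_mul_of_nonneg_left (hA c hc) (abs_nonneg _)
    · rw [kernel_eq_zero_of_bound T N b hT hc, abs_zero, zero_mul, zero_mul]
  calc ‖∑ c, (T (Pi.single c 1) b) • A c‖ ≤ ∑ c, |T (Pi.single c 1) b| * M := norm_sum_le_of_le _ fun c _ => hterm c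
    _ = (∑ c, |T (Pi.single c 1) b|) * M := by rw [sum_mul]
    _ ≤ C * M := mul_le_mul_of_nonneg_right (sum_abs_kernel_le_of_bound T N b hT) hM

end ByEntry

/-! ## §2 The scalar operators of the engine as `ℝ`-linear maps -/

section ScalarLinear

/-- Walk sums are homogeneous. [folklore] -/
theorem wsum_smul (r : ℝ) (a : PBond P j → ℝ) : ∀ (w : List (Letter P.d)) (x : Site P j), wsum (r • a) x w = r * wsum a x w
  | [], x => by simp
  | (μ, true) :: w, x => by rw [wsum_cons_true, wsum_cons_true, wsum_smul r a w, Pi.smul_apply, smul_eq_mul]; ring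
  | (μ, false) :: w, x => by rw [wsum_cons_false, wsum_cons_false, wsum_smul r a w, Pi.smul_apply, smul_eq_mul]; ring

/-- The (0.4)-linear average is homogeneous. [cite: Balaban1987RG1, (0.4) p.253] -/
theorem linAvg04_smul (r : ℝ) (a : PBond P j → ℝ) : linAvg04 (r • a) = r • linAvg04 a := by
  funext c
  simp only [Pi.smul_apply, linAvg04, loopSum, axialSum, wsum_smul, ← mul_sum, smul_eq_mul]
  ring

/-- The iterated (0.4)-linear average is homogeneous. [cite: Balaban1987RG1, (0.11) p.253] -/
theorem linAvgIter_smul (r : ℝ) : ∀ (s : ℕ) (a : PBond P 0 → ℝ), linAvgIter s (r • a) = r • linAvgIter s a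
  | 0, _ => rfl
  | s + 1, a => by rw [linAvgIter_succ, linAvgIter_succ, linAvgIter_smul r s a, linAvg04_smul]

/-- **THE (0.4)-LINEAR AVERAGE AS AN `ℝ`-LINEAR MAP** `Ω¹(T^{(j)}) → Ω¹(T^{(j+1)})`. [cite: Balaban1987RG1, (0.4) p.253] -/
def linAvg04L (P : Params) (j : ℕ) : (PBond P j → ℝ) →ₗ[ℝ] (PBond P (j + 1) → ℝ) where
  toFun := linAvg04
  map_add' := linAvg04_add
  map_smul' := linAvg04_smul

/-- `linAvg04L` is `linAvg04`. [cite: Balaban1987RG1, (0.4) p.253] -/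
@[simp] theorem linAvg04L_apply (a : PBond P j → ℝ) : linAvg04L P j a = linAvg04 a := rfl

/-- **THE ITERATED (0.4)-LINEAR AVERAGE AS AN `ℝ`-LINEAR MAP** `Ω¹(T^{(0)}) → Ω¹(T^{(s)})`. [cite: Balaban1987RG1, (0.11) p.253] -/
def linAvgIterL (P : Params) (s : ℕ) : (PBond P 0 → ℝ) →ₗ[ℝ] (PBond P s → ℝ) where
  toFun := linAvgIter s
  map_add' := linAvgIter_add s
  map_smul' r a := linAvgIter_smul r s a

/-- `linAvgIterL` is `linAvgIter`. [cite: Balaban1987RG1, (0.11) p.253] -/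
@[simp] theorem linAvgIterL_apply (s : ℕ) (a : PBond P 0 → ℝ) : linAvgIterL P s a = linAvgIter s a := rfl

/-- `stairMean` is additive. [folklore] -/
theorem stairMean_add (a b : PBond P j → ℝ) (y : Site P (j + 1)) : stairMean (a + b) y = stairMean a y + stairMean b y := by
  unfold stairMean stairSum
  simp_rw [wsum_add]
  rw [sum_add_distrib, mul_add]

/-- `stairMean` is homogeneous. [folklore] -/
theorem stairMean_smul (r : ℝ) (a : PBond P j → ℝ) (y : Site P (j + 1)) : stairMean (r • a) y = r * stairMean a y := by
  unfold stairMean stairSum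
  simp_rw [wsum_smul, ← mul_sum]
  ring

/-- `ptMean` is additive. [folklore] -/
theorem ptMean_add (g g' : Site P j → ℝ) (y : Site P (j + 1)) : ptMean (g + g') y = ptMean g y + ptMean g' y := by
  unfold ptMean
  simp only [Pi.add_apply, sum_add_distrib, mul_add]

/-- `ptMean` is homogeneous. [folklore] -/
theorem ptMean_smul (r : ℝ) (g : Site P j → ℝ) (y : Site P (j + 1)) : ptMean (r • g) y = r * ptMean g y := by
  unfold ptMean
  simp only [Pi.smul_apply, smul_eq_mul, ← mul_sum]
  ring

/-- The coboundary potential `Ψ_s` is additive. [cite: Balaban1987RG1, (0.4) p.253 (bookkeeping)] -/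
theorem psiIter_add : ∀ (s : ℕ) (a b : PBond P 0 → ℝ), psiIter s (a + b) = psiIter s a + psiIter s b
  | 0, _, _ => by funext y; simp [psiIter]
  | s + 1, a, b => by
    funext y
    rw [Pi.add_apply]
    simp only [psiIter]
    rw [psiIter_add s a b, linAvgIter_add, ptMean_add, stairMean_add]
    ring

/-- The coboundary potential `Ψ_s` is homogeneous. [cite: Balaban1987RG1, (0.4) p.253 (bookkeeping)] -/
theorem psiIter_smul (r : ℝ) : ∀ (s : ℕ) (a : PBond P 0 → ℝ), psiIter s (r • a) = r • psiIter s a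
  | 0, _ => by funext y; simp [psiIter]
  | s + 1, a => by
    funext y
    rw [Pi.smul_apply, smul_eq_mul]
    simp only [psiIter]
    rw [psiIter_smul r s a, linAvgIter_smul, ptMean_smul, stairMean_smul]
    ring

/-- `dgrad` is homogeneous. [folklore] -/
theorem dgrad_smul (r : ℝ) (g : Site P j → ℝ) : dgrad (r • g) = r • dgrad g := by
  funext b; simp only [dgrad, Pi.smul_apply, smul_eq_mul]; ring

/-- The spreading operator `S¹` is additive. [folklore] -/
theorem S1_add (k : ℕ) (A B : PBond P k → ℝ) : S1 k (A + B) = S1 k A + S1 k B := by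
  funext b
  simp only [S1, Pi.add_apply, add_mul, sum_add_distrib]

/-- The spreading operator `S¹` is homogeneous. [folklore] -/
theorem S1_smul (k : ℕ) (r : ℝ) (A : PBond P k → ℝ) : S1 k (r • A) = r • S1 k A := by
  funext b
  simp only [S1, Pi.smul_apply, smul_eq_mul, mul_sum]
  refine sum_congr rfl fun y _ => ?_
  ring

/-- **THE EXACT LINEAR LIFT IS ADDITIVE**. [cite: Balaban1987RG1, (0.4)+(0.11) p.253] -/
theorem lift_add (k : ℕ) (A B : PBond P k → ℝ) : lift k (A + B) = lift k A + lift k B := by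
  unfold lift
  rw [S1_add, psiIter_add]
  funext b
  simp only [Pi.add_apply, Pi.sub_apply, dgrad]
  ring

/-- **THE EXACT LINEAR LIFT IS HOMOGENEOUS**. [cite: Balaban1987RG1, (0.4)+(0.11) p.253] -/
theorem lift_smul (k : ℕ) (r : ℝ) (A : PBond P k → ℝ) : lift k (r • A) = r • lift k A := by
  unfold lift
  rw [S1_smul, psiIter_smul]
  funext b
  simp only [Pi.smul_apply, Pi.sub_apply, dgrad, smul_eq_mul]
  ring

/-- **THE SPREADING OPERATOR `S¹` AS AN `ℝ`-LINEAR MAP**. [folklore] -/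
def S1L (P : Params) (k : ℕ) : (PBond P k → ℝ) →ₗ[ℝ] (PBond P 0 → ℝ) where
  toFun := S1 k
  map_add' := S1_add k
  map_smul' := S1_smul k

/-- `S1L` is `S1`. [folklore] -/
@[simp] theorem S1L_apply (k : ℕ) (A : PBond P k → ℝ) : S1L P k A = S1 k A := rfl

/-- **THE COBOUNDARY POTENTIAL `Ψ_s` AS AN `ℝ`-LINEAR MAP**. [cite: Balaban1987RG1, (0.4) p.253 (bookkeeping)] -/
def psiIterL (P : Params) (s : ℕ) : (PBond P 0 → ℝ) →ₗ[ℝ] (Site P s → ℝ) where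
  toFun := psiIter s
  map_add' := psiIter_add s
  map_smul' r a := psiIter_smul r s a

/-- `psiIterL` is `psiIter`. [cite: Balaban1987RG1, (0.4) p.253 (bookkeeping)] -/
@[simp] theorem psiIterL_apply (s : ℕ) (a : PBond P 0 → ℝ) : psiIterL P s a = psiIter s a := rfl

/-- **THE EXACT LINEAR LIFT AS AN `ℝ`-LINEAR MAP** `Ω¹(T^{(k)}) → Ω¹(T^{(0)})`. [cite: Balaban1987RG1, (0.4)+(0.11) p.253] -/
def liftL (P : Params) (k : ℕ) : (PBond P k → ℝ) →ₗ[ℝ] (PBond P 0 → ℝ) where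
  toFun := lift k
  map_add' := lift_add k
  map_smul' := lift_smul k

/-- `liftL` is `lift`. [cite: Balaban1987RG1, (0.4)+(0.11) p.253] -/
@[simp] theorem liftL_apply (k : ℕ) (A : PBond P k → ℝ) : liftL P k A = lift k A := rfl

end ScalarLinear

end Summit.QuantumFields.YangMills.Theorems.LinearLiftMatrix

end
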